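import Summits.QuantumFields.YangMills.Theorems.WeakCouplingRatesColdBoxDirichletShiftedMean
import Literature.Probability.Distributions.GaussianWickTheorem

/-!
# Crux `BulkDominatesColdBoxW` (stmt-QuantumFields-19609), interfaces `KernelCovExpansion` / `FlatCovExpansion`: conditioning an `L⁴` connected
# two-point function on a likely event, and the instance for the quadratic plaquette observables of the mean-shifted Dirichlet Gaussian

Companion of `Theorems/WeakCouplingRatesColdBoxDirichletShiftedMean.lean` (`abs_integral_sub_integral_cond_le_of_sq`: `|E X − E[X|G]| ≤ 2(1+E X²)√η`)
and `…ColdBoxDirichletShiftedCov.lean` (the exact covariance).  In the one-scale expansion the Gaussian side is reached on a small-field event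
`G̃` only; this file removes the restriction for COVARIANCES of observables with four moments:

* `abs_cov_sub_cov_cond_le_of_fourth` — general probability space: if `μ(Gᶜ) ≤ η ≤ 1/2` and `f, g` have fourth moments then
  `|Cov_μ(f,g) − Cov_{μ[|G]}(f,g)| ≤ (2 + E f⁴ + E g⁴ + 6(1 + E f²)(1 + E g²))·√η`
  (the `L∞` version is `abs_cov_sub_cov_cond_le`, `Theorems/WeakCouplingRatesColdBoxGoodEvent.lean`);
* one colour: `integral_dirCirc_pow_eight` (`E_D[X⁸] = 105V⁴`, Wick), `integral_const_add_dirCirc_pow_eight_le` (`E_D[(F+X)⁸] ≤ 128(F⁸ + 105V⁴)`);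
* three colours: `integral_quadObs_pow_four_pi_le` (`E_{D^{⊗3}}[f⁴] ≤ 216Σ_c(F_c⁸ + 105V⁴)`, `f = ½Σ_c (F_c + X_q(t_c))²`), `memLp_four_quadObs_pi`;
* **`abs_cov_cond_quadObs_sub_le`** — for every measurable `G̃` with `D^{⊗3}(G̃ᶜ) ≤ η ≤ 1/2`, the conditioned covariance of `f_p, g_q` is within
  `(2 + Q_p + Q_q + 6(1+S_p)(1+S_q))·√η` of the unconditioned one, `S_r = 6Σ_c(F_c⁴ + 3V_r²)`, `Q_r = 216Σ_c(F_c⁸ + 105V_r⁴)`; the unconditioned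
  value `(3/2)·C² + (Σ_c F_cG_c)·C` is `cov_quadObs_pi_eq` of `…ColdBoxDirichletShiftedCov.lean` (kept separate so this file does not import it).

Fleet seat `ym-spine-20043-p1` (g3; work split 22:20Z with the line lead `ym-wcr-19609-p1`: Gaussian side).  No sorry, standard axioms, no new definition,
no named-fact hypothesis.  NOT a claim about the mass gap.
-/

set_option autoImplicit false

noncomputable section

open MeasureTheory ProbabilityTheory Finset Real
open Literature.Probability.LatticeModels
open Literature.MathematicalPhysics.QuantumLattice
open Literature.MathematicalPhysics.QuantumFieldTheory
open Literature.MathematicalPhysics.QuantumFieldTheory.LatticeMaxwell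
open Literature.MathematicalPhysics.QuantumFieldTheory.AxialGauge
open Literature.Probability.Distributions

namespace Summit.QuantumFields.YangMills.Theorems.WeakCouplingRates

/-! ## §1 Conditioning an `L⁴` covariance on a likely event -/

section CondCov

variable {Ω : Type*} [MeasurableSpace Ω] {μ : Measure Ω} [IsProbabilityMeasure μ] {G : Set Ω}

omit [IsProbabilityMeasure μ] in
/-- The product of two functions with fourth moments is square integrable: `(fg)² ≤ (f⁴ + g⁴)/2`. -/
theorem memLp_two_mul_of_integrable_pow_four {f g : Ω → ℝ} (hf : AEStronglyMeasurable f μ) (hg : AEStronglyMeasurable g μ)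
    (hf4 : Integrable (fun ω => f ω ^ 4) μ) (hg4 : Integrable (fun ω => g ω ^ 4) μ) :
    MemLp (fun ω => f ω * g ω) 2 μ ∧ ∫ ω, (f ω * g ω) ^ 2 ∂μ ≤ ((∫ ω, f ω ^ 4 ∂μ) + ∫ ω, g ω ^ 4 ∂μ) / 2 := by
  have hpt : ∀ ω, (f ω * g ω) ^ 2 ≤ (f ω ^ 4 + g ω ^ 4) / 2 := fun ω => by nlinarith [sq_nonneg (f ω ^ 2 - g ω ^ 2)]
  have hint : Integrable (fun ω => (f ω * g ω) ^ 2) μ := by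
    refine Integrable.mono' ((hf4.add hg4).div_const 2) ((hf.mul hg).pow 2) (ae_of_all _ fun ω => ?_)
    rw [Real.norm_eq_abs, abs_of_nonneg (sq_nonneg _)]
    exact hpt ω
  refine ⟨(memLp_two_iff_integrable_sq (hf.mul hg)).2 hint, ?_⟩
  calc ∫ ω, (f ω * g ω) ^ 2 ∂μ ≤ ∫ ω, (f ω ^ 4 + g ω ^ 4) / 2 ∂μ := integral_mono hint ((hf4.add hg4).div_const 2) hpt
    _ = ((∫ ω, f ω ^ 4 ∂μ) + ∫ ω, g ω ^ 4 ∂μ) / 2 := by rw [integral_div, integral_add hf4 hg4]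

/-- `f ∈ L²` from a fourth moment (finite measure): `f² ≤ (1 + f⁴)/2`. -/
theorem memLp_two_of_integrable_pow_four {f : Ω → ℝ} (hf : AEStronglyMeasurable f μ) (h4 : Integrable (fun ω => f ω ^ 4) μ) :
    MemLp f 2 μ ∧ ∫ ω, f ω ^ 2 ∂μ ≤ (1 + ∫ ω, f ω ^ 4 ∂μ) / 2 := by
  have hpt : ∀ ω, f ω ^ 2 ≤ (1 + f ω ^ 4) / 2 := fun ω => by nlinarith [sq_nonneg (f ω ^ 2 - 1)]
  have hint : Integrable (fun ω => f ω ^ 2) μ := by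
    refine Integrable.mono' (((integrable_const (1 : ℝ)).add h4).div_const 2) (hf.pow 2) (ae_of_all _ fun ω => ?_)
    rw [Real.norm_eq_abs, abs_of_nonneg (sq_nonneg _)]
    exact hpt ω
  refine ⟨(memLp_two_iff_integrable_sq hf).2 hint, ?_⟩
  calc ∫ ω, f ω ^ 2 ∂μ ≤ ∫ ω, (1 + f ω ^ 4) / 2 ∂μ := integral_mono hint (((integrable_const (1 : ℝ)).add h4).div_const 2) hpt
    _ = (1 + ∫ ω, f ω ^ 4 ∂μ) / 2 := by
        rw [integral_div, integral_add (integrable_const _) h4, integral_const, smul_eq_mul, probReal_univ, one_mul]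

/-- **Conditioning on a likely event moves an `L⁴` connected two-point function by `O(√(μ(bad)))`**: if `μ(Gᶜ) ≤ η ≤ 1/2` and `f, g`
have fourth moments `Q_f = E f⁴`, `Q_g = E g⁴` and second moments `S_f, S_g`, then
`|Cov_μ(f,g) − Cov_{μ[|G]}(f,g)| ≤ (2 + Q_f + Q_g + 6(1+S_f)(1+S_g))·√η`. -/
theorem abs_cov_sub_cov_cond_le_of_fourth (hG : MeasurableSet G) {f g : Ω → ℝ} (hf : AEStronglyMeasurable f μ)
    (hg : AEStronglyMeasurable g μ) (hf4 : Integrable (fun ω => f ω ^ 4) μ) (hg4 : Integrable (fun ω => g ω ^ 4) μ)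
    {η : ℝ} (hη : μ.real Gᶜ ≤ η) (hη2 : η ≤ 1 / 2) :
    |((∫ ω, f ω * g ω ∂μ) - (∫ ω, f ω ∂μ) * (∫ ω, g ω ∂μ)) -
        ((∫ ω, f ω * g ω ∂(μ[|G])) - (∫ ω, f ω ∂(μ[|G])) * (∫ ω, g ω ∂(μ[|G])))| ≤
      (2 + (∫ ω, f ω ^ 4 ∂μ) + (∫ ω, g ω ^ 4 ∂μ) + 6 * (1 + ∫ ω, f ω ^ 2 ∂μ) * (1 + ∫ ω, g ω ^ 2 ∂μ)) * Real.sqrt η := by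
  obtain ⟨hfg2, hfg_le⟩ := memLp_two_mul_of_integrable_pow_four hf hg hf4 hg4
  obtain ⟨hf2, -⟩ := memLp_two_of_integrable_pow_four hf hf4
  obtain ⟨hg2, -⟩ := memLp_two_of_integrable_pow_four hg hg4
  set Sf := ∫ ω, f ω ^ 2 ∂μ with hSf
  set Sg := ∫ ω, g ω ^ 2 ∂μ with hSg
  set Qf := ∫ ω, f ω ^ 4 ∂μ with hQf
  set Qg := ∫ ω, g ω ^ 4 ∂μ with hQg
  have hSf0 : 0 ≤ Sf := integral_nonneg fun ω => sq_nonneg _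
  have hSg0 : 0 ≤ Sg := integral_nonneg fun ω => sq_nonneg _
  have hQf0 : 0 ≤ Qf := integral_nonneg fun ω => by positivity
  have hQg0 : 0 ≤ Qg := integral_nonneg fun ω => by positivity
  have hη0 : 0 ≤ η := le_trans measureReal_nonneg hη
  have hs0 : 0 ≤ Real.sqrt η := Real.sqrt_nonneg η
  have hs1 : Real.sqrt η ≤ 1 := by rw [Real.sqrt_le_one]; linarith
  -- the three elementary moves
  have d1 := abs_integral_sub_integral_cond_le_of_sq hG hfg2 hη hη2
  have d2 := abs_integral_sub_integral_cond_le_of_sq hG hf2 hη hη2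
  have d3 := abs_integral_sub_integral_cond_le_of_sq hG hg2 hη hη2
  have d1' : |(∫ ω, f ω * g ω ∂μ) - ∫ ω, f ω * g ω ∂(μ[|G])| ≤ 2 * (1 + (Qf + Qg) / 2) * Real.sqrt η := by
    refine d1.trans (mul_le_mul_of_nonneg_right ?_ hs0)
    linarith
  -- sizes of the unconditioned means
  have hEf : |∫ ω, f ω ∂μ| ≤ (1 + Sf) / 2 := by
    have h1 : |∫ ω, f ω ∂μ| ≤ ∫ ω, |f ω| ∂μ := abs_integral_le_integral_abs
    have h2 : ∫ ω, |f ω| ∂μ ≤ ∫ ω, (1 + f ω ^ 2) / 2 ∂μ := by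
      refine integral_mono (hf2.integrable one_le_two).abs (((integrable_const (1 : ℝ)).add hf2.integrable_sq).div_const 2) fun ω => ?_
      have e : f ω ^ 2 = |f ω| ^ 2 := (sq_abs _).symm
      simp only [e]
      nlinarith [sq_nonneg (|f ω| - 1)]
    have h3 : ∫ ω, (1 + f ω ^ 2) / 2 ∂μ = (1 + Sf) / 2 := by
      rw [integral_div, integral_add (integrable_const _) hf2.integrable_sq, integral_const, smul_eq_mul, probReal_univ, one_mul]
    linarith
  have hEg : |∫ ω, g ω ∂μ| ≤ (1 + Sg) / 2 := by
    have h1 : |∫ ω, g ω ∂μ| ≤ ∫ ω, |g ω| ∂μ := abs_integral_le_integral_abs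
    have h2 : ∫ ω, |g ω| ∂μ ≤ ∫ ω, (1 + g ω ^ 2) / 2 ∂μ := by
      refine integral_mono (hg2.integrable one_le_two).abs (((integrable_const (1 : ℝ)).add hg2.integrable_sq).div_const 2) fun ω => ?_
      have e : g ω ^ 2 = |g ω| ^ 2 := (sq_abs _).symm
      simp only [e]
      nlinarith [sq_nonneg (|g ω| - 1)]
    have h3 : ∫ ω, (1 + g ω ^ 2) / 2 ∂μ = (1 + Sg) / 2 := by
      rw [integral_div, integral_add (integrable_const _) hg2.integrable_sq, integral_const, smul_eq_mul, probReal_univ, one_mul]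
    linarith
  -- the conditioned mean of `g`
  have hEGg : |∫ ω, g ω ∂(μ[|G])| ≤ (1 + Sg) / 2 + 2 * (1 + Sg) * Real.sqrt η := by
    have := abs_sub_abs_le_abs_sub (∫ ω, g ω ∂(μ[|G])) (∫ ω, g ω ∂μ)
    rw [abs_sub_comm] at d3
    linarith
  -- product of means
  set A := ∫ ω, f ω ∂μ with hA
  set B := ∫ ω, g ω ∂μ with hB
  set A' := ∫ ω, f ω ∂(μ[|G]) with hA'
  set B' := ∫ ω, g ω ∂(μ[|G]) with hB'
  have hprod : |A * B - A' * B'| ≤ 6 * (1 + Sf) * (1 + Sg) * Real.sqrt η := by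
    have e : A * B - A' * B' = A * (B - B') + (A - A') * B' := by ring
    rw [e]
    refine (abs_add_le _ _).trans ?_
    rw [abs_mul, abs_mul]
    have t1 : |A| * |B - B'| ≤ (1 + Sf) / 2 * (2 * (1 + Sg) * Real.sqrt η) := mul_le_mul hEf d3 (abs_nonneg _) (by positivity)
    have t2 : |A - A'| * |B'| ≤ (2 * (1 + Sf) * Real.sqrt η) * ((1 + Sg) / 2 + 2 * (1 + Sg) * Real.sqrt η) :=
      mul_le_mul d2 hEGg (abs_nonneg _) (by positivity)
    have t3 : (2 * (1 + Sf) * Real.sqrt η) * ((1 + Sg) / 2 + 2 * (1 + Sg) * Real.sqrt η) ≤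
        (2 * (1 + Sf) * Real.sqrt η) * ((1 + Sg) / 2 + 2 * (1 + Sg)) := by
      refine mul_le_mul_of_nonneg_left ?_ (by positivity)
      nlinarith
    nlinarith
  -- assemble
  have e : ((∫ ω, f ω * g ω ∂μ) - A * B) - ((∫ ω, f ω * g ω ∂(μ[|G])) - A' * B') =
      ((∫ ω, f ω * g ω ∂μ) - ∫ ω, f ω * g ω ∂(μ[|G])) - (A * B - A' * B') := by ring
  rw [e]
  refine (abs_sub _ _).trans ?_
  nlinarith

end CondCov

/-! ## §2 Eighth moments of the shifted Dirichlet circulation, fourth moments of the quadratic observable -/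

section Moments

variable {H : ℕ}

/-- `E_D[X_q⁸] = 105·V_D(q)⁴` (Wick). -/
theorem integral_dirCirc_pow_eight (q : Plaq 4) :
    ∫ t, dirCirc H q t ^ 8 ∂(boxDirichlet H) = 105 * boxDirProjKernel H q q ^ 4 := by
  have h : ∫ t, dirCirc H q t ^ 8 ∂(boxDirichlet H) =
      ((Nat.doubleFactorial (2 * 4 - 1) : ℕ) : ℝ) * (∫ t, dirCirc H q t ^ 2 ∂(boxDirichlet H)) ^ 4 :=
    GaussianWick.integral_pow_even_eq (isGaussianProcess_dirCirc H) integral_dirCirc q 4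
  rw [h, integral_dirCirc_sq]
  norm_num [Nat.doubleFactorial]

/-- `(a + b)⁸ ≤ 128(a⁸ + b⁸)`. -/
theorem add_pow_eight_le (a b : ℝ) : (a + b) ^ 8 ≤ 128 * (a ^ 8 + b ^ 8) := by
  have h1 : (a + b) ^ 2 ≤ 2 * (a ^ 2 + b ^ 2) := by nlinarith [sq_nonneg (a - b)]
  have h2 : (a ^ 2 + b ^ 2) ^ 2 ≤ 2 * (a ^ 4 + b ^ 4) := by nlinarith [sq_nonneg (a ^ 2 - b ^ 2)]
  have h3 : (a ^ 4 + b ^ 4) ^ 2 ≤ 2 * (a ^ 8 + b ^ 8) := by nlinarith [sq_nonneg (a ^ 4 - b ^ 4)]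
  have h0 : 0 ≤ (a + b) ^ 2 := sq_nonneg _
  have h0' : 0 ≤ a ^ 2 + b ^ 2 := by positivity
  have h0'' : 0 ≤ a ^ 4 + b ^ 4 := by positivity
  calc (a + b) ^ 8 = ((a + b) ^ 2) ^ 4 := by ring
    _ ≤ (2 * (a ^ 2 + b ^ 2)) ^ 4 := pow_le_pow_left₀ h0 h1 4
    _ = 16 * ((a ^ 2 + b ^ 2) ^ 2) ^ 2 := by ring
    _ ≤ 16 * (2 * (a ^ 4 + b ^ 4)) ^ 2 := by gcongr
    _ = 64 * (a ^ 4 + b ^ 4) ^ 2 := by ring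
    _ ≤ 64 * (2 * (a ^ 8 + b ^ 8)) := by gcongr
    _ = 128 * (a ^ 8 + b ^ 8) := by ring

/-- `E_D[(F + X_q)⁸]` exists. -/
theorem integrable_const_add_dirCirc_pow_eight (F : ℝ) (q : Plaq 4) :
    Integrable (fun t => (F + dirCirc H q t) ^ 8) (boxDirichlet H) := by
  have hFX : MemLp (fun t => F + dirCirc H q t) 8 (boxDirichlet H) :=
    (memLp_const F).add (((isGaussianProcess_dirCirc H).hasGaussianLaw_eval q).memLp (by norm_num))
  refine (hFX.integrable_norm_pow (by norm_num)).congr (ae_of_all _ fun t => ?_)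
  simp only [Real.norm_eq_abs]
  exact (show Even 8 by decide).pow_abs _

/-- **Shifted eighth moment**: `E_D[(F + X_q)⁸] ≤ 128(F⁸ + 105V_D(q)⁴)`. -/
theorem integral_const_add_dirCirc_pow_eight_le (F : ℝ) (q : Plaq 4) :
    ∫ t, (F + dirCirc H q t) ^ 8 ∂(boxDirichlet H) ≤ 128 * (F ^ 8 + 105 * boxDirProjKernel H q q ^ 4) := by
  have hX8 : Integrable (fun t => dirCirc H q t ^ 8) (boxDirichlet H) := by
    refine ((((isGaussianProcess_dirCirc H).hasGaussianLaw_eval q).memLp (by norm_num) :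
      MemLp (dirCirc H q) 8 (boxDirichlet H)).integrable_norm_pow (by norm_num)).congr (ae_of_all _ fun t => ?_)
    simp only [Real.norm_eq_abs]
    exact (show Even 8 by decide).pow_abs _
  calc ∫ t, (F + dirCirc H q t) ^ 8 ∂(boxDirichlet H) ≤ ∫ t, 128 * (F ^ 8 + dirCirc H q t ^ 8) ∂(boxDirichlet H) :=
        integral_mono (integrable_const_add_dirCirc_pow_eight F q) (((integrable_const _).add hX8).const_mul _)
          fun t => add_pow_eight_le F (dirCirc H q t)
    _ = 128 * (F ^ 8 + 105 * boxDirProjKernel H q q ^ 4) := by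
        rw [integral_const_mul, integral_add (integrable_const _) hX8, integral_const, integral_dirCirc_pow_eight, smul_eq_mul,
          probReal_univ, one_mul]

/-- `(y₀ + y₁ + y₂)⁴ ≤ 27(y₀⁴ + y₁⁴ + y₂⁴)`. -/
theorem sum_three_pow_four_le (y₀ y₁ y₂ : ℝ) : (y₀ + y₁ + y₂) ^ 4 ≤ 27 * (y₀ ^ 4 + y₁ ^ 4 + y₂ ^ 4) := by
  have h1 : (y₀ + y₁ + y₂) ^ 2 ≤ 3 * (y₀ ^ 2 + y₁ ^ 2 + y₂ ^ 2) := by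
    nlinarith [sq_nonneg (y₀ - y₁), sq_nonneg (y₁ - y₂), sq_nonneg (y₀ - y₂)]
  have h2 : (y₀ ^ 2 + y₁ ^ 2 + y₂ ^ 2) ^ 2 ≤ 3 * (y₀ ^ 4 + y₁ ^ 4 + y₂ ^ 4) := by
    nlinarith [sq_nonneg (y₀ ^ 2 - y₁ ^ 2), sq_nonneg (y₁ ^ 2 - y₂ ^ 2), sq_nonneg (y₀ ^ 2 - y₂ ^ 2)]
  have h0 : 0 ≤ (y₀ + y₁ + y₂) ^ 2 := sq_nonneg _
  calc (y₀ + y₁ + y₂) ^ 4 = ((y₀ + y₁ + y₂) ^ 2) ^ 2 := by ring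
    _ ≤ (3 * (y₀ ^ 2 + y₁ ^ 2 + y₂ ^ 2)) ^ 2 := pow_le_pow_left₀ h0 h1 2
    _ = 9 * (y₀ ^ 2 + y₁ ^ 2 + y₂ ^ 2) ^ 2 := by ring
    _ ≤ 9 * (3 * (y₀ ^ 4 + y₁ ^ 4 + y₂ ^ 4)) := by gcongr
    _ = 27 * (y₀ ^ 4 + y₁ ^ 4 + y₂ ^ 4) := by ring

/-- The fourth power of the three-colour quadratic observable is integrable, and
**`E_{D^{⊗3}}[(½Σ_c (F_c + X_q(t_c))²)⁴] ≤ 216Σ_c (F_c⁸ + 105V_D(q)⁴)`**. -/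
theorem integral_quadObs_pow_four_pi_le (F : Fin 3 → ℝ) (q : Plaq 4) :
    Integrable (fun t : Fin 3 → EuclideanSpace ℝ (DirFree H) => ((1 / 2 : ℝ) * ∑ c, (F c + dirCirc H q (t c)) ^ 2) ^ 4)
        (Measure.pi fun _ : Fin 3 => boxDirichlet H) ∧
      ∫ t : Fin 3 → EuclideanSpace ℝ (DirFree H), ((1 / 2 : ℝ) * ∑ c, (F c + dirCirc H q (t c)) ^ 2) ^ 4
          ∂(Measure.pi fun _ : Fin 3 => boxDirichlet H) ≤ 216 * ∑ c, (F c ^ 8 + 105 * boxDirProjKernel H q q ^ 4) := by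
  set P3 := Measure.pi fun _ : Fin 3 => boxDirichlet H with hP3
  have h8 : ∀ c : Fin 3, Integrable (fun t : Fin 3 → EuclideanSpace ℝ (DirFree H) => (F c + dirCirc H q (t c)) ^ 8) P3 := fun c =>
    integrable_comp_eval_pi (integrable_const_add_dirCirc_pow_eight (F c) q) c
  have hpt : ∀ t : Fin 3 → EuclideanSpace ℝ (DirFree H),
      ((1 / 2 : ℝ) * ∑ c, (F c + dirCirc H q (t c)) ^ 2) ^ 4 ≤ 27 / 16 * ∑ c, (F c + dirCirc H q (t c)) ^ 8 := by
    intro t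
    simp only [Fin.sum_univ_three]
    have h := sum_three_pow_four_le ((F 0 + dirCirc H q (t 0)) ^ 2) ((F 1 + dirCirc H q (t 1)) ^ 2) ((F 2 + dirCirc H q (t 2)) ^ 2)
    have e : ∀ x : ℝ, (x ^ 2) ^ 4 = x ^ 8 := fun x => by ring
    rw [e, e, e] at h
    calc ((1 / 2 : ℝ) * ((F 0 + dirCirc H q (t 0)) ^ 2 + (F 1 + dirCirc H q (t 1)) ^ 2 + (F 2 + dirCirc H q (t 2)) ^ 2)) ^ 4
        = ((F 0 + dirCirc H q (t 0)) ^ 2 + (F 1 + dirCirc H q (t 1)) ^ 2 + (F 2 + dirCirc H q (t 2)) ^ 2) ^ 4 / 16 := by ring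
      _ ≤ 27 * ((F 0 + dirCirc H q (t 0)) ^ 8 + (F 1 + dirCirc H q (t 1)) ^ 8 + (F 2 + dirCirc H q (t 2)) ^ 8) / 16 :=
          div_le_div_of_nonneg_right h (by norm_num)
      _ = 27 / 16 * ((F 0 + dirCirc H q (t 0)) ^ 8 + (F 1 + dirCirc H q (t 1)) ^ 8 + (F 2 + dirCirc H q (t 2)) ^ 8) := by ring
  have hmeas : AEStronglyMeasurable (fun t : Fin 3 → EuclideanSpace ℝ (DirFree H) => ((1 / 2 : ℝ) * ∑ c, (F c + dirCirc H q (t c)) ^ 2) ^ 4) P3 :=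
    (memLp_two_quadObs_pi F q).aestronglyMeasurable.pow 4
  have hint : Integrable (fun t : Fin 3 → EuclideanSpace ℝ (DirFree H) => ((1 / 2 : ℝ) * ∑ c, (F c + dirCirc H q (t c)) ^ 2) ^ 4) P3 := by
    refine Integrable.mono' ((integrable_finsetSum Finset.univ fun c _ => h8 c).const_mul (27 / 16)) hmeas (ae_of_all _ fun t => ?_)
    rw [Real.norm_eq_abs, abs_of_nonneg (by positivity)]
    exact hpt t
  refine ⟨hint, ?_⟩
  calc ∫ t, ((1 / 2 : ℝ) * ∑ c, (F c + dirCirc H q (t c)) ^ 2) ^ 4 ∂P3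
      ≤ ∫ t, 27 / 16 * ∑ c, (F c + dirCirc H q (t c)) ^ 8 ∂P3 :=
        integral_mono hint ((integrable_finsetSum Finset.univ fun c _ => h8 c).const_mul _) hpt
    _ = 27 / 16 * ∑ c, ∫ s, (F c + dirCirc H q s) ^ 8 ∂(boxDirichlet H) := by
        rw [integral_const_mul, integral_finsetSum _ fun c _ => h8 c]
        congr 1
        exact Finset.sum_congr rfl fun c _ => integral_pi_eval (boxDirichlet H) (fun s => (F c + dirCirc H q s) ^ 8) c
    _ ≤ 27 / 16 * ∑ c, 128 * (F c ^ 8 + 105 * boxDirProjKernel H q q ^ 4) := by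
        gcongr with c _
        exact integral_const_add_dirCirc_pow_eight_le (F c) q
    _ = 216 * ∑ c, (F c ^ 8 + 105 * boxDirProjKernel H q q ^ 4) := by rw [← Finset.mul_sum]; ring

end Moments

/-! ## §3 The instance: conditioned covariance of the quadratic observables -/

section Instance

variable {H : ℕ}

/-- **Restriction of the Gaussian covariance to a likely event.**  For backgrounds `F` (at `p`), `G` (at `q`), the observables
`f = ½Σ_c (F_c + X_p(t_c))²`, `g = ½Σ_c (G_c + X_q(t_c))²` on the three-colour space, and every measurable `G̃` with `D^{⊗3}(G̃ᶜ) ≤ η ≤ 1/2`: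
`|Cov_{D^{⊗3}}(f,g) − Cov_{D^{⊗3}[|G̃]}(f,g)| ≤ (2 + Q_p + Q_q + 6(1+S_p)(1+S_q))·√η` with the explicit moment bounds
`S_r = 6Σ_c(F_c⁴ + 3V_r²)` (`integral_quadObs_sq_pi_le`) and `Q_r = 216Σ_c(F_c⁸ + 105V_r⁴)` (`integral_quadObs_pow_four_pi_le`).  Combine with
`cov_quadObs_pi_eq` (`Theorems/WeakCouplingRatesColdBoxDirichletShiftedCov.lean`) for the exact unconditioned value `(3/2)C² + (Σ_c F_cG_c)C`. -/
theorem abs_cov_cond_quadObs_sub_le (F G : Fin 3 → ℝ) (p q : Plaq 4)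
    {S : Set (Fin 3 → EuclideanSpace ℝ (DirFree H))} (hS : MeasurableSet S) {η : ℝ}
    (hη : (Measure.pi fun _ : Fin 3 => boxDirichlet H).real Sᶜ ≤ η) (hη2 : η ≤ 1 / 2) :
    |((∫ t, ((1 / 2 : ℝ) * ∑ c, (F c + dirCirc H p (t c)) ^ 2) * ((1 / 2 : ℝ) * ∑ c, (G c + dirCirc H q (t c)) ^ 2)
            ∂(Measure.pi fun _ : Fin 3 => boxDirichlet H)) -
          (∫ t, (1 / 2 : ℝ) * ∑ c, (F c + dirCirc H p (t c)) ^ 2 ∂(Measure.pi fun _ : Fin 3 => boxDirichlet H)) *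
            (∫ t, (1 / 2 : ℝ) * ∑ c, (G c + dirCirc H q (t c)) ^ 2 ∂(Measure.pi fun _ : Fin 3 => boxDirichlet H))) -
        ((∫ t, ((1 / 2 : ℝ) * ∑ c, (F c + dirCirc H p (t c)) ^ 2) * ((1 / 2 : ℝ) * ∑ c, (G c + dirCirc H q (t c)) ^ 2)
            ∂((Measure.pi fun _ : Fin 3 => boxDirichlet H)[|S])) -
          (∫ t, (1 / 2 : ℝ) * ∑ c, (F c + dirCirc H p (t c)) ^ 2 ∂((Measure.pi fun _ : Fin 3 => boxDirichlet H)[|S])) *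
            (∫ t, (1 / 2 : ℝ) * ∑ c, (G c + dirCirc H q (t c)) ^ 2 ∂((Measure.pi fun _ : Fin 3 => boxDirichlet H)[|S])))| ≤
      (2 + 216 * ∑ c, (F c ^ 8 + 105 * boxDirProjKernel H p p ^ 4) + 216 * ∑ c, (G c ^ 8 + 105 * boxDirProjKernel H q q ^ 4) +
          6 * (1 + 6 * ∑ c, (F c ^ 4 + 3 * boxDirProjKernel H p p ^ 2)) * (1 + 6 * ∑ c, (G c ^ 4 + 3 * boxDirProjKernel H q q ^ 2))) *
        Real.sqrt η := by
  obtain ⟨hf4, hQf⟩ := integral_quadObs_pow_four_pi_le (H := H) F p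
  obtain ⟨hg4, hQg⟩ := integral_quadObs_pow_four_pi_le (H := H) G q
  have hSf := integral_quadObs_sq_pi_le (H := H) F p
  have hSg := integral_quadObs_sq_pi_le (H := H) G q
  have h := abs_cov_sub_cov_cond_le_of_fourth (μ := Measure.pi fun _ : Fin 3 => boxDirichlet H) hS
    (memLp_two_quadObs_pi F p).aestronglyMeasurable (memLp_two_quadObs_pi G q).aestronglyMeasurable hf4 hg4 hη hη2
  refine h.trans (mul_le_mul_of_nonneg_right ?_ (Real.sqrt_nonneg η))
  have hSf0 : 0 ≤ ∫ t, ((1 / 2 : ℝ) * ∑ c, (F c + dirCirc H p (t c)) ^ 2) ^ 2 ∂(Measure.pi fun _ : Fin 3 => boxDirichlet H) :=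
    integral_nonneg fun t => sq_nonneg _
  have hSg0 : 0 ≤ ∫ t, ((1 / 2 : ℝ) * ∑ c, (G c + dirCirc H q (t c)) ^ 2) ^ 2 ∂(Measure.pi fun _ : Fin 3 => boxDirichlet H) :=
    integral_nonneg fun t => sq_nonneg _
  nlinarith [mul_le_mul (add_le_add_left hSf 1) (add_le_add_left hSg 1) (by linarith) (by linarith)]

end Instance

end Summit.QuantumFields.YangMills.Theorems.WeakCouplingRates

end
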